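import Summits.Ventures.CertifiedManyBodySolver.Observables.MeanFieldClassExclusionObjectE
import HarnessLib

/-!
# Ventures/CertifiedManyBodySolver — Observables/MeanFieldClassExclusionObjectEHg.lean

HONEST FRAMING: first certified bounds; not a superconductivity verdict; every number certified or labelled float.
A competing-order EXCLUSION removes a named class of candidate ground states; it never says which order is present;
no phase sentence follows.

Cell `hubbard-tc` (MO-S3, D-0096), seat `hubbard-tc-mod-3` (G3), `prover-hubbard-tc-mod-3-g3-0`. File 2/2 of the deep-`t′` object-E words
(devices and the Na-CCOC / NdNiO₂ words: `MeanFieldClassExclusionObjectE.lean`): the HgBa₂CuO₄₊δ per-column object-E boxes (M19b p = ⅛,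
M19 p = 0.16, and the first PRESSURE column p = 0.16 @ 10 GPa) and the R-nickelate hold-out La₀.₈Sr₀.₂NiO₂ (M39a). Every word: for the
stated `t′`-range, EVERY `U ≥ U₁` and the box's filling band, every GS torus limit `ω` of unit `(rectN n L, S^z = 0)`-sector ground states of
`hubbardTorusTT' L 1 t′ U` has `Re ω(n_{0↑} n_{0↓}) < (n/2)²` (no non-magnetic quasi-free / HF / singlet-BCS ground state; Wick ⇒ `docc ≥ (n/2)²`,
Bach–Lieb–Solovej 1994 §2). The slivers `t′ ∈ [−0.54, −1/2]` of the Hg boxes lie beyond the Fermi-sea adapter's `|t′| ≤ 1/2`; there the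
`−1/2` tangent column is carried by the kinematic Lipschitz bound `|e(s) − e(s′)| ≤ 1.6212|s − s′|`
(`energyDensityTT'_tPrime_transport_ge_decimal`), so the WHOLE Hg object-E boxes carry the word for `U ≥ 6.5` (p = ⅛) / `U ≥ 7` (p = 0.16).

* `hgE_p0125_docc_lt_of` (t′ ∈ [−1/2, −0.43], `U ≥ 6`) + `hgE_p0125_deep_docc_lt_of` (t′ ∈ [−0.54, −1/2], `U ≥ 6.5`) — M19b, n ∈ [0.835, 0.915];
* `hgE_p016_docc_lt_of` (`U ≥ 6.4`) + `hgE_p016_deep_docc_lt_of` (`U ≥ 7`) — M19, n ∈ [0.80, 0.88];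
* `hgE_P10_p016_docc_lt_of` — 10 GPa column `[3.0, 8.5] × [−0.49, −0.35] × [0.79, 0.88]`, `U ≥ 6.5`;
* `lsnoE_x02_docc_lt_of` — La₀.₈Sr₀.₂NiO₂ (M39a) `[5.1, 8.4] × [−0.47, −0.35] × [0.714, 0.814]`, `U ≥ 7.4` (Pr₀.₈Sr₀.₂NiO₂ M39b, `U/t_eff ≤ 6.8`:
  no word — the test first passes at `U = 7.2`).

Claim nodes #445 (`cert_dbt329pair_allk`), #473 (`cert_r473_…`), #472 (`cert_r472_pb2_tl_upper_n1_U8`) BY HYPOTHESIS. WHAT THIS IS NOT: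
a statement about stripes, d-wave order or T_c; the saturated-FM class; tight.

References: T. Koma, H. Tasaki, J. Stat. Phys. 76 (1994) 745, §1 [KomaTasaki1994]; V. Bach, E. H. Lieb, J. P. Solovej,
J. Stat. Phys. 76 (1994) 3, eq. (2c.36) [BachLiebSolovej1994]; E. H. Lieb, M. Loss, Duke Math. J. 71 (1993) 337, §8 Thm 8.2
[LiebLoss1993]; R. B. Israel, Convexity in the Theory of Lattice Gases (1979), Thm I.3.4 [Israel1979]; D. Ruelle,
Statistical Mechanics (1969) §3.3 [Ruelle1969].
-/

noncomputable section

namespace Summit.Ventures.CertifiedManyBodySolver.Observables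

open Literature.MathematicalPhysics.QuantumLattice
open Literature.MathematicalPhysics.QuantumLattice.ThermodynamicLimit
open Summit.Ventures.CertifiedManyBodySolver.Certificates
open Matrix HubbardWave0 Literature.Probability.LatticeModels Filter Topology
open scoped ComplexOrder BigOperators


/-- **HgBa₂CuO₄₊δ p = ⅛ (VSET M19b), per-column OBJECT E `[3.5, 8.8] × [−0.54, −0.43] × [0.835, 0.915]` — MF/BCS class excluded on
the sub-box `t′ ≥ −1/2`, `U ≥ 6`** (the sliver `t′ ∈ [−0.54, −1/2)` is outside the Fermi-sea adapter's `|t′| ≤ 1/2` and stays cert-num). Claim nodes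
#445, #473, #472; tangent rows at `n₀ = 7/8` on the columns `−1/2, −2/5`; smallest margin `+0.015`. [cite: KomaTasaki1994, §1] [cite: BachLiebSolovej1994, eq. (2c.36)] [cite: LiebLoss1993, §8, Theorem 8.2] -/
theorem hgE_p0125_docc_lt_of (h445 : cert_dbt329pair_allk)
    (h473 : cert_r473_bs_M3U8tp0_w3_b4_R2_ob5p2_kry1_kry2c3rel_hanK7B4D4_KN4_PR20d4_hanK8c2s_hanK8B4D4_uprime)
    (h472 : cert_r472_pb2_tl_upper_n1_U8)
    {t' U n : ℝ} (ht1 : -1 / 2 ≤ t') (ht2 : t' ≤ -43 / 100) (hU : 6 ≤ U)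
    (hn1 : 167 / 200 ≤ n) (hn2 : n ≤ 183 / 200) :
    ∀ (ω : InfVolFermionState 2) (Ls : ℕ → ℕ) (ψ : ∀ L, Fock (Orb (FermionTorus 2 L))),
      Tendsto Ls atTop atTop →
      (∀ j, IsGroundStateInSector (hubbardTorusTT' (Ls j) 1 t' U) (rectN n (Ls j)) 0 (ψ (Ls j))) →
      (∀ j, star (ψ (Ls j)) ⬝ᵥ ψ (Ls j) = 1) → ω.IsTorusLimitOf ψ Ls →
      (ω.expect ({0} : Finset (Site 2))
        (nAt 0 (Finset.mem_singleton_self 0) 0 * nAt 0 (Finset.mem_singleton_self 0) 1)).re < (n / 2) ^ 2 := by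
  have hn0 : (0 : ℝ) ≤ n := by linarith
  have hn2' : n < 2 := by linarith
  have hnpos : (0 : ℝ) < n := by linarith
  -- the class constant `(n/2)²` above its tangent at `n = 167 / 200`, scaled by the threshold `U₁ = 6`
  have hsq : (-27889 / 160000 : ℝ) + 167 / 400 * n ≤ (n / 2) ^ 2 := by nlinarith [sq_nonneg (n - 167 / 200)]
  have hsqU : ((-27889 / 160000 : ℝ) + 167 / 400 * n) * (6) ≤ (n / 2) ^ 2 * (6) :=
    mul_le_mul_of_nonneg_right hsq (by norm_num)
  have hC8 := objE_halfFilling_cap8 h472 t'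
  have hR := objE_conc78_cap8 h445 h473 (s := t') (by linarith)
  have hBs : (0 : ℝ) ≤ -0.6023622600 * t' := mul_nonneg_of_nonpos_of_nonpos (by norm_num) (by linarith)
  have ra := fermiSeaTangentRow_tPrime_neg_one_div_two_at_seven_div_eight (U := 0) le_rfl hn0 hn2'
  have rb := fermiSeaTangentRow_tPrime_neg_two_div_five_at_seven_div_eight (U := 0) le_rfl hn0 hn2'
  have hfl := objE_floor_between (s := t') hn0 hn2' (by norm_num : (-1 / 2 : ℝ) ≤ -2 / 5) ra rb (by linarith) (by linarith)
  rcases le_or_gt n (7 / 8) with hb | hb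
  · have hcap := objE_lowBand_cap8 hR hBs hnpos hb le_rfl
    exact doccN_lt_of_cap8_threshold (U₁ := 6) (by norm_num) (by norm_num) hU hn0 hn2' hcap hfl
      (sub_min_lt_of (by linarith) (by linarith))
  · have hcap := objE_highBand_cap8 hR hC8 hBs (m := 7 / 8) hb.le hb (by linarith)
    exact doccN_lt_of_cap8_threshold (U₁ := 6) (by norm_num) (by norm_num) hU hn0 hn2' hcap hfl
      (sub_min_lt_of (by linarith) (by linarith))

/-- **HgBa₂CuO₄₊δ p = 0.16 (VSET M19), per-column OBJECT E `[3.5, 8.8] × [−0.54, −0.43] × [0.80, 0.88]` — MF/BCS class excluded on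
the sub-box `t′ ≥ −1/2`, `U ≥ 32/5`.** Claim nodes #445, #473, #472; tangent rows at `n₀ = 21/25`; smallest margin `+0.008`. [cite: KomaTasaki1994, §1] [cite: BachLiebSolovej1994, eq. (2c.36)] [cite: LiebLoss1993, §8, Theorem 8.2] -/
theorem hgE_p016_docc_lt_of (h445 : cert_dbt329pair_allk)
    (h473 : cert_r473_bs_M3U8tp0_w3_b4_R2_ob5p2_kry1_kry2c3rel_hanK7B4D4_KN4_PR20d4_hanK8c2s_hanK8B4D4_uprime)
    (h472 : cert_r472_pb2_tl_upper_n1_U8)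
    {t' U n : ℝ} (ht1 : -1 / 2 ≤ t') (ht2 : t' ≤ -43 / 100) (hU : 32 / 5 ≤ U)
    (hn1 : 4 / 5 ≤ n) (hn2 : n ≤ 22 / 25) :
    ∀ (ω : InfVolFermionState 2) (Ls : ℕ → ℕ) (ψ : ∀ L, Fock (Orb (FermionTorus 2 L))),
      Tendsto Ls atTop atTop →
      (∀ j, IsGroundStateInSector (hubbardTorusTT' (Ls j) 1 t' U) (rectN n (Ls j)) 0 (ψ (Ls j))) →
      (∀ j, star (ψ (Ls j)) ⬝ᵥ ψ (Ls j) = 1) → ω.IsTorusLimitOf ψ Ls →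
      (ω.expect ({0} : Finset (Site 2))
        (nAt 0 (Finset.mem_singleton_self 0) 0 * nAt 0 (Finset.mem_singleton_self 0) 1)).re < (n / 2) ^ 2 := by
  have hn0 : (0 : ℝ) ≤ n := by linarith
  have hn2' : n < 2 := by linarith
  have hnpos : (0 : ℝ) < n := by linarith
  -- the class constant `(n/2)²` above its tangent at `n = 4 / 5`, scaled by the threshold `U₁ = 32 / 5`
  have hsq : (-4 / 25 : ℝ) + 2 / 5 * n ≤ (n / 2) ^ 2 := by nlinarith [sq_nonneg (n - 4 / 5)]
  have hsqU : ((-4 / 25 : ℝ) + 2 / 5 * n) * (32 / 5) ≤ (n / 2) ^ 2 * (32 / 5) :=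
    mul_le_mul_of_nonneg_right hsq (by norm_num)
  have hC8 := objE_halfFilling_cap8 h472 t'
  have hR := objE_conc78_cap8 h445 h473 (s := t') (by linarith)
  have hBs : (0 : ℝ) ≤ -0.6023622600 * t' := mul_nonneg_of_nonpos_of_nonpos (by norm_num) (by linarith)
  have ra := fermiSeaTangentRow_tPrime_neg_one_div_two_at_twentyone_div_twentyfive (U := 0) le_rfl hn0 hn2'
  have rb := fermiSeaTangentRow_tPrime_neg_two_div_five_at_twentyone_div_twentyfive (U := 0) le_rfl hn0 hn2'
  have hfl := objE_floor_between (s := t') hn0 hn2' (by norm_num : (-1 / 2 : ℝ) ≤ -2 / 5) ra rb (by linarith) (by linarith)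
  rcases le_or_gt n (7 / 8) with hb | hb
  · have hcap := objE_lowBand_cap8 hR hBs hnpos hb le_rfl
    exact doccN_lt_of_cap8_threshold (U₁ := 32 / 5) (by norm_num) (by norm_num) hU hn0 hn2' hcap hfl
      (sub_min_lt_of (by linarith) (by linarith))
  · have hcap := objE_highBand_cap8 hR hC8 hBs (m := 7 / 8) hb.le hb (by linarith)
    exact doccN_lt_of_cap8_threshold (U₁ := 32 / 5) (by norm_num) (by norm_num) hU hn0 hn2' hcap hfl
      (sub_min_lt_of (by linarith) (by linarith))

/-- **HgBa₂CuO₄₊δ p = 0.16 at P = 10 GPa (VSET M19 @10), per-column OBJECT E `[3.0, 8.5] × [−0.49, −0.35] × [0.79, 0.88]` — MF/BCS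
class excluded on the sub-box `U ≥ 13/2`** (first PRESSURE column of the G3 back-end). Claim nodes #445, #473, #472; tangent rows at `n₀ = 21/25`
on the three columns; smallest margin `+0.008`. [cite: KomaTasaki1994, §1] [cite: BachLiebSolovej1994, eq. (2c.36)] [cite: LiebLoss1993, §8, Theorem 8.2] -/
theorem hgE_P10_p016_docc_lt_of (h445 : cert_dbt329pair_allk)
    (h473 : cert_r473_bs_M3U8tp0_w3_b4_R2_ob5p2_kry1_kry2c3rel_hanK7B4D4_KN4_PR20d4_hanK8c2s_hanK8B4D4_uprime)
    (h472 : cert_r472_pb2_tl_upper_n1_U8)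
    {t' U n : ℝ} (ht1 : -49 / 100 ≤ t') (ht2 : t' ≤ -7 / 20) (hU : 13 / 2 ≤ U)
    (hn1 : 79 / 100 ≤ n) (hn2 : n ≤ 22 / 25) :
    ∀ (ω : InfVolFermionState 2) (Ls : ℕ → ℕ) (ψ : ∀ L, Fock (Orb (FermionTorus 2 L))),
      Tendsto Ls atTop atTop →
      (∀ j, IsGroundStateInSector (hubbardTorusTT' (Ls j) 1 t' U) (rectN n (Ls j)) 0 (ψ (Ls j))) →
      (∀ j, star (ψ (Ls j)) ⬝ᵥ ψ (Ls j) = 1) → ω.IsTorusLimitOf ψ Ls →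
      (ω.expect ({0} : Finset (Site 2))
        (nAt 0 (Finset.mem_singleton_self 0) 0 * nAt 0 (Finset.mem_singleton_self 0) 1)).re < (n / 2) ^ 2 := by
  have hn0 : (0 : ℝ) ≤ n := by linarith
  have hn2' : n < 2 := by linarith
  have hnpos : (0 : ℝ) < n := by linarith
  -- the class constant `(n/2)²` above its tangent at `n = 79 / 100`, scaled by the threshold `U₁ = 13 / 2`
  have hsq : (-6241 / 40000 : ℝ) + 79 / 200 * n ≤ (n / 2) ^ 2 := by nlinarith [sq_nonneg (n - 79 / 100)]
  have hsqU : ((-6241 / 40000 : ℝ) + 79 / 200 * n) * (13 / 2) ≤ (n / 2) ^ 2 * (13 / 2) :=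
    mul_le_mul_of_nonneg_right hsq (by norm_num)
  have hC8 := objE_halfFilling_cap8 h472 t'
  have hR := objE_conc78_cap8 h445 h473 (s := t') (by linarith)
  have hBs : (0 : ℝ) ≤ -0.6023622600 * t' := mul_nonneg_of_nonpos_of_nonpos (by norm_num) (by linarith)
  have ra := fermiSeaTangentRow_tPrime_neg_one_div_two_at_twentyone_div_twentyfive (U := 0) le_rfl hn0 hn2'
  have rb := fermiSeaTangentRow_tPrime_neg_two_div_five_at_twentyone_div_twentyfive (U := 0) le_rfl hn0 hn2'
  have rc := fermiSeaTangentRow_tPrime_neg_three_div_ten_at_twentyone_div_twentyfive (U := 0) le_rfl hn0 hn2'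
  rcases le_or_gt t' (-2 / 5) with hp | hp
  · -- piece `t' ∈ [-49 / 100, -2/5]`: columns `-1/2`, `-2/5`
    have hfl := objE_floor_between hn0 hn2' (by norm_num : (-1 / 2 : ℝ) ≤ -2 / 5) ra rb (by linarith) hp
    rcases le_or_gt n (7 / 8) with hb | hb
    · have hcap := objE_lowBand_cap8 hR hBs hnpos hb le_rfl
      exact doccN_lt_of_cap8_threshold (U₁ := 13 / 2) (by norm_num) (by norm_num) hU hn0 hn2' hcap hfl
        (sub_min_lt_of (by linarith) (by linarith))
    · have hcap := objE_highBand_cap8 hR hC8 hBs (m := 7 / 8) hb.le hb (by linarith)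
      exact doccN_lt_of_cap8_threshold (U₁ := 13 / 2) (by norm_num) (by norm_num) hU hn0 hn2' hcap hfl
        (sub_min_lt_of (by linarith) (by linarith))
  · -- piece `t' ∈ (-2/5, -7 / 20]`: columns `-2/5`, `-3/10`
    have hfl := objE_floor_between hn0 hn2' (by norm_num : (-2 / 5 : ℝ) ≤ -3 / 10) rb rc hp.le (by linarith)
    rcases le_or_gt n (7 / 8) with hb | hb
    · have hcap := objE_lowBand_cap8 hR hBs hnpos hb le_rfl
      exact doccN_lt_of_cap8_threshold (U₁ := 13 / 2) (by norm_num) (by norm_num) hU hn0 hn2' hcap hfl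
        (sub_min_lt_of (by linarith) (by linarith))
    · have hcap := objE_highBand_cap8 hR hC8 hBs (m := 7 / 8) hb.le hb (by linarith)
      exact doccN_lt_of_cap8_threshold (U₁ := 13 / 2) (by norm_num) (by norm_num) hU hn0 hn2' hcap hfl
        (sub_min_lt_of (by linarith) (by linarith))

/-- **La₀.₈Sr₀.₂NiO₂ (VSET M39a, W3 HOLD-OUT), BOX OF RECORD #26, OBJECT E `[5.1, 8.4] × [−0.47, −0.35] × [0.714, 0.814]` — MF/BCS class
excluded on the sub-box `U ≥ 37/5`.** Claim nodes #445, #473 (band below `7/8`); tangent rows at `n₀ = 3/4`; smallest margin `+0.004`. (Pr₀.₈Sr₀.₂NiO₂, M39b,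
`U/t_eff ≤ 6.8`: the same test first passes at `U = 7.2` — no kernel word on its box.) [cite: KomaTasaki1994, §1] [cite: BachLiebSolovej1994, eq. (2c.36)] [cite: LiebLoss1993, §8, Theorem 8.2] -/
theorem lsnoE_x02_docc_lt_of (h445 : cert_dbt329pair_allk)
    (h473 : cert_r473_bs_M3U8tp0_w3_b4_R2_ob5p2_kry1_kry2c3rel_hanK7B4D4_KN4_PR20d4_hanK8c2s_hanK8B4D4_uprime)
    {t' U n : ℝ} (ht1 : -47 / 100 ≤ t') (ht2 : t' ≤ -7 / 20) (hU : 37 / 5 ≤ U)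
    (hn1 : 357 / 500 ≤ n) (hn2 : n ≤ 407 / 500) :
    ∀ (ω : InfVolFermionState 2) (Ls : ℕ → ℕ) (ψ : ∀ L, Fock (Orb (FermionTorus 2 L))),
      Tendsto Ls atTop atTop →
      (∀ j, IsGroundStateInSector (hubbardTorusTT' (Ls j) 1 t' U) (rectN n (Ls j)) 0 (ψ (Ls j))) →
      (∀ j, star (ψ (Ls j)) ⬝ᵥ ψ (Ls j) = 1) → ω.IsTorusLimitOf ψ Ls →
      (ω.expect ({0} : Finset (Site 2))
        (nAt 0 (Finset.mem_singleton_self 0) 0 * nAt 0 (Finset.mem_singleton_self 0) 1)).re < (n / 2) ^ 2 := by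
  have hn0 : (0 : ℝ) ≤ n := by linarith
  have hn2' : n < 2 := by linarith
  have hnpos : (0 : ℝ) < n := by linarith
  -- the class constant `(n/2)²` above its tangent at `n = 357 / 500`, scaled by the threshold `U₁ = 37 / 5`
  have hsq : (-127449 / 1000000 : ℝ) + 357 / 1000 * n ≤ (n / 2) ^ 2 := by nlinarith [sq_nonneg (n - 357 / 500)]
  have hsqU : ((-127449 / 1000000 : ℝ) + 357 / 1000 * n) * (37 / 5) ≤ (n / 2) ^ 2 * (37 / 5) :=
    mul_le_mul_of_nonneg_right hsq (by norm_num)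
  have hR := objE_conc78_cap8 h445 h473 (s := t') (by linarith)
  have hBs : (0 : ℝ) ≤ -0.6023622600 * t' := mul_nonneg_of_nonpos_of_nonpos (by norm_num) (by linarith)
  have ra := fermiSeaTangentRow_tPrime_neg_one_div_two_at_three_div_four (U := 0) le_rfl hn0 hn2'
  have rb := fermiSeaTangentRow_tPrime_neg_two_div_five_at_three_div_four (U := 0) le_rfl hn0 hn2'
  have rc := fermiSeaTangentRow_tPrime_neg_three_div_ten_at_three_div_four (U := 0) le_rfl hn0 hn2'
  rcases le_or_gt t' (-2 / 5) with hp | hp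
  · -- piece `t' ∈ [-47 / 100, -2/5]`: columns `-1/2`, `-2/5`
    have hfl := objE_floor_between hn0 hn2' (by norm_num : (-1 / 2 : ℝ) ≤ -2 / 5) ra rb (by linarith) hp
    have hcap := objE_lowBand_cap8 hR hBs hnpos hn2 (by norm_num)
    exact doccN_lt_of_cap8_threshold (U₁ := 37 / 5) (by norm_num) (by norm_num) hU hn0 hn2' hcap hfl
      (sub_min_lt_of (by linarith) (by linarith))
  · -- piece `t' ∈ (-2/5, -7 / 20]`: columns `-2/5`, `-3/10`
    have hfl := objE_floor_between hn0 hn2' (by norm_num : (-2 / 5 : ℝ) ≤ -3 / 10) rb rc hp.le (by linarith)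
    have hcap := objE_lowBand_cap8 hR hBs hnpos hn2 (by norm_num)
    exact doccN_lt_of_cap8_threshold (U₁ := 37 / 5) (by norm_num) (by norm_num) hU hn0 hn2' hcap hfl
      (sub_min_lt_of (by linarith) (by linarith))

/-- **HgBa₂CuO₄₊δ p = ⅛ (M19b), the deep sliver `t′ ∈ [−27/50, −1/2]` of the per-column object-E box** (beyond the Fermi-sea adapter's
`|t′| ≤ 1/2`): MF/BCS class excluded for every `U ≥ 13/2`, `n ∈ [0.835, 0.915]` — floor = the tangent row at the column `−1/2` (touch `7/8`) carried
by the kinematic Lipschitz bound `|e(s) − e(s′)| ≤ 1.6212|s − s′|` (`energyDensityTT'_tPrime_transport_ge_decimal`), cap = the `t′`-chord (valid at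
every `t′ ≤ −1/4`); smallest margin `+0.013`. WITH `hgE_p0125_docc_lt_of`: the WHOLE M19b object-E box `[−0.54, −0.43] × [0.835, 0.915]` carries the
word for every `U ≥ 6.5` (= the seat's cert-num threshold). [cite: KomaTasaki1994, §1] [cite: BachLiebSolovej1994, eq. (2c.36)] [cite: LiebLoss1993, §8, Theorem 8.2] -/
theorem hgE_p0125_deep_docc_lt_of (h445 : cert_dbt329pair_allk)
    (h473 : cert_r473_bs_M3U8tp0_w3_b4_R2_ob5p2_kry1_kry2c3rel_hanK7B4D4_KN4_PR20d4_hanK8c2s_hanK8B4D4_uprime)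
    (h472 : cert_r472_pb2_tl_upper_n1_U8)
    {t' U n : ℝ} (ht1 : -27 / 50 ≤ t') (ht2 : t' ≤ -1 / 2) (hU : 13 / 2 ≤ U)
    (hn1 : 167 / 200 ≤ n) (hn2 : n ≤ 183 / 200) :
    ∀ (ω : InfVolFermionState 2) (Ls : ℕ → ℕ) (ψ : ∀ L, Fock (Orb (FermionTorus 2 L))),
      Tendsto Ls atTop atTop →
      (∀ j, IsGroundStateInSector (hubbardTorusTT' (Ls j) 1 t' U) (rectN n (Ls j)) 0 (ψ (Ls j))) →
      (∀ j, star (ψ (Ls j)) ⬝ᵥ ψ (Ls j) = 1) → ω.IsTorusLimitOf ψ Ls →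
      (ω.expect ({0} : Finset (Site 2))
        (nAt 0 (Finset.mem_singleton_self 0) 0 * nAt 0 (Finset.mem_singleton_self 0) 1)).re < (n / 2) ^ 2 := by
  have hn0 : (0 : ℝ) ≤ n := by linarith
  have hn2' : n < 2 := by linarith
  have hnpos : (0 : ℝ) < n := by linarith
  have hsq : (-27889 / 160000 : ℝ) + 167 / 400 * n ≤ (n / 2) ^ 2 := by nlinarith [sq_nonneg (n - 167 / 200)]
  have hsqU : ((-27889 / 160000 : ℝ) + 167 / 400 * n) * (13 / 2) ≤ (n / 2) ^ 2 * (13 / 2) :=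
    mul_le_mul_of_nonneg_right hsq (by norm_num)
  have hC8 := objE_halfFilling_cap8 h472 t'
  have hR := objE_conc78_cap8 h445 h473 (s := t') (by linarith)
  have hBs : (0 : ℝ) ≤ -0.6023622600 * t' := mul_nonneg_of_nonpos_of_nonpos (by norm_num) (by linarith)
  -- floor: the tangent row at the column `-1/2` carried to `t' < -1/2` by the kinematic Lipschitz bound `1.6212·|t' + 1/2|`
  have ra := fermiSeaTangentRow_tPrime_neg_one_div_two_at_seven_div_eight (U := 0) le_rfl hn0 hn2'
  have htr := energyDensityTT'_tPrime_transport_ge_decimal 1 (U := 0) le_rfl hn0 hn2' (-1 / 2) t'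
  rw [abs_of_nonpos (by linarith : t' - -1 / 2 ≤ 0)] at htr
  have hfl : energyDensityTT' 1 (-1 / 2) 0 n - 1.6212 * (-(t' - -1 / 2)) ≤ energyDensityTT' 1 t' 0 n := htr
  rcases le_or_gt n (7 / 8) with hb | hb
  · have hcap := objE_lowBand_cap8 hR hBs hnpos hb le_rfl
    exact doccN_lt_of_cap8_threshold (U₁ := 13 / 2) (by norm_num) (by norm_num) hU hn0 hn2' hcap hfl (by linarith)
  · have hcap := objE_highBand_cap8 hR hC8 hBs (m := 7 / 8) hb.le hb (by linarith)
    exact doccN_lt_of_cap8_threshold (U₁ := 13 / 2) (by norm_num) (by norm_num) hU hn0 hn2' hcap hfl (by linarith)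

/-- **HgBa₂CuO₄₊δ p = 0.16 (M19), deep sliver `t′ ∈ [−27/50, −1/2]`**: MF/BCS class excluded for every `U ≥ 7`,
`n ∈ [0.80, 0.88]` (same devices; margin `+0.015`). WITH `hgE_p016_docc_lt_of`: the whole M19 object-E box carries the word for every `U ≥ 7.0`
(cert-num 6.8). [cite: KomaTasaki1994, §1] [cite: BachLiebSolovej1994, eq. (2c.36)] [cite: LiebLoss1993, §8, Theorem 8.2] -/
theorem hgE_p016_deep_docc_lt_of (h445 : cert_dbt329pair_allk)
    (h473 : cert_r473_bs_M3U8tp0_w3_b4_R2_ob5p2_kry1_kry2c3rel_hanK7B4D4_KN4_PR20d4_hanK8c2s_hanK8B4D4_uprime)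
    (h472 : cert_r472_pb2_tl_upper_n1_U8)
    {t' U n : ℝ} (ht1 : -27 / 50 ≤ t') (ht2 : t' ≤ -1 / 2) (hU : 7 ≤ U)
    (hn1 : 4 / 5 ≤ n) (hn2 : n ≤ 22 / 25) :
    ∀ (ω : InfVolFermionState 2) (Ls : ℕ → ℕ) (ψ : ∀ L, Fock (Orb (FermionTorus 2 L))),
      Tendsto Ls atTop atTop →
      (∀ j, IsGroundStateInSector (hubbardTorusTT' (Ls j) 1 t' U) (rectN n (Ls j)) 0 (ψ (Ls j))) →
      (∀ j, star (ψ (Ls j)) ⬝ᵥ ψ (Ls j) = 1) → ω.IsTorusLimitOf ψ Ls →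
      (ω.expect ({0} : Finset (Site 2))
        (nAt 0 (Finset.mem_singleton_self 0) 0 * nAt 0 (Finset.mem_singleton_self 0) 1)).re < (n / 2) ^ 2 := by
  have hn0 : (0 : ℝ) ≤ n := by linarith
  have hn2' : n < 2 := by linarith
  have hnpos : (0 : ℝ) < n := by linarith
  have hsq : (-4 / 25 : ℝ) + 2 / 5 * n ≤ (n / 2) ^ 2 := by nlinarith [sq_nonneg (n - 4 / 5)]
  have hsqU : ((-4 / 25 : ℝ) + 2 / 5 * n) * (7) ≤ (n / 2) ^ 2 * (7) :=
    mul_le_mul_of_nonneg_right hsq (by norm_num)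
  have hC8 := objE_halfFilling_cap8 h472 t'
  have hR := objE_conc78_cap8 h445 h473 (s := t') (by linarith)
  have hBs : (0 : ℝ) ≤ -0.6023622600 * t' := mul_nonneg_of_nonpos_of_nonpos (by norm_num) (by linarith)
  -- floor: the tangent row at the column `-1/2` carried to `t' < -1/2` by the kinematic Lipschitz bound `1.6212·|t' + 1/2|`
  have ra := fermiSeaTangentRow_tPrime_neg_one_div_two_at_twentyone_div_twentyfive (U := 0) le_rfl hn0 hn2'
  have htr := energyDensityTT'_tPrime_transport_ge_decimal 1 (U := 0) le_rfl hn0 hn2' (-1 / 2) t'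
  rw [abs_of_nonpos (by linarith : t' - -1 / 2 ≤ 0)] at htr
  have hfl : energyDensityTT' 1 (-1 / 2) 0 n - 1.6212 * (-(t' - -1 / 2)) ≤ energyDensityTT' 1 t' 0 n := htr
  rcases le_or_gt n (7 / 8) with hb | hb
  · have hcap := objE_lowBand_cap8 hR hBs hnpos hb le_rfl
    exact doccN_lt_of_cap8_threshold (U₁ := 7) (by norm_num) (by norm_num) hU hn0 hn2' hcap hfl (by linarith)
  · have hcap := objE_highBand_cap8 hR hC8 hBs (m := 7 / 8) hb.le hb (by linarith)
    exact doccN_lt_of_cap8_threshold (U₁ := 7) (by norm_num) (by norm_num) hU hn0 hn2' hcap hfl (by linarith)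

end Summit.Ventures.CertifiedManyBodySolver.Observables

end
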